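import Summits.CriticalPhenomena.CardyFormulaZ2.Theorems.HalfPlaneMarkDensityLaw.Negative.MarkEvents
import Summits.CriticalPhenomena.CardyFormulaZ2.Theorems.CardyBoundaryCoulombGasHalfPlaneMarkDensityLawTwoArmPoint
import Summits.CriticalPhenomena.CardyFormulaZ2.Theorems.CardyBoundaryCoulombGasHalfPlaneMarkDensityLawSymmDiffInclusion
import Summits.CriticalPhenomena.CardyFormulaZ2.Theorems.CardyBoundaryCoulombGasHalfPlaneMarkDensityLawIsolationIndep
import Literature.Probability.Percolation.RSW

/-!
# The lattice mark density is Lipschitz at scale `n⁻²` (line `Sketch`, stub L)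

Crux `Summit.CriticalPhenomena.CardyFormulaZ2.Theses.CardyBoundaryCoulombGas.HalfPlaneMarkDensityLaw`
(stmt-CriticalPhenomena-5661), line `Sketch`, stub `stub_shiftLipschitz_of`.

For critical bond percolation `μ = P_{1/2}` on `ℤ²`, the lattice mark density
`g n k = P[E(k)]`, `E(k) = firstHit halfPlane A_n ⌊cn⌋ k` (`A_n = [⌊an⌋,⌊bn⌋] × {0}`), satisfies
`|g n k' − g n k| ≤ C (k' − k) / n²` for `⌊x₀ n⌋ ≤ k ≤ k'` (`c < x₀`), GIVEN the three statements of
the line: the two-arm point bound `P[isolated arm to distance R] ≤ C_A / R` (A), the deterministic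
four-case inclusion of the symmetric difference of `E(k)` and its translate (I), and the
independence of isolation events in disjoint half-boxes (P).  This file is the bookkeeping assembly:

* exact translation (tree `measureReal_firstHit_shift`): `g n (k+1)` is `P` of the event `E(k)` with
  the three integer marks moved one site to the left;
* `|P E' − P E| ≤ P (E ∆ E')` and (I) a.e. (`ae_subset_edgeSet`): `P (E ∆ E') ≤
  P[liso k ∩ (liso β ∪ riso (α−1) ∪ riso (γ−1))]`, radius `R = ⌊εn⌋₊`, `4ε = min (b−a, c−b, x₀−c)`;
* union bound, (P) and (A): `≤ 3 (C_A/R)² ≤ 12 C_A² / (ε² n²)` once `εn ≥ 2`;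
* telescoping in `k`, and the crude bound `|g n k' − g n k| ≤ 1 ≤ n₀² (k'−k)/n²` for `n < n₀`.

Sources: folklore (elementary measure theory).  No named facts are used; A, I, P enter as hypotheses.
-/

noncomputable section

namespace Summit.CriticalPhenomena.CardyFormulaZ2.Cruxes.HalfPlaneMarkDensityLaw.SketchLine

open Literature.Probability.Percolation Literature.Probability.LatticeModels
open MeasureTheory Filter Set
open Summit.CriticalPhenomena.CardyFormulaZ2.Theorems.HalfPlaneMarkDensityLaw.Negative

namespace Shift

/-- The half-box `Λ⁺_R(m) = [m−R, m+R] × [0, R]` around the boundary vertex `(m,0)`. [folklore] -/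
def hb (m : ℤ) (R : ℕ) : Set (Site 2) :=
  {v : Site 2 | 0 ≤ v 1 ∧ v 1 ≤ (R : ℤ) ∧ m - R ≤ v 0 ∧ v 0 ≤ m + R}

/-- The outer rim of the half-box: its left, right and top sides. [folklore] -/
def hrim (m : ℤ) (R : ℕ) : Set (Site 2) :=
  {v : Site 2 | v 0 = m - R ∨ v 0 = m + R ∨ v 1 = (R : ℤ)}

/-- Left-isolated arm at `(m,0)` to distance `R`: `(m,0)` is joined to the rim inside `Λ⁺_R(m)` and
no vertex of `[m−R, m−1] × {0}` is joined to `(m,0)` inside `Λ⁺_R(m)`. [folklore] -/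
def liso (m : ℤ) (R : ℕ) : Set (BondConfig (Site 2)) :=
  openCrossing (hb m R) {bpt m} (hrim m R) \ openCrossing (hb m R) (rowIcc (m - R) (m - 1)) {bpt m}

/-- Right-isolated arm at `(m,0)` to distance `R`: as `liso` with `[m+1, m+R] × {0}` excluded.
[folklore] -/
def riso (m : ℤ) (R : ℕ) : Set (BondConfig (Site 2)) :=
  openCrossing (hb m R) {bpt m} (hrim m R) \ openCrossing (hb m R) (rowIcc (m + 1) (m + R)) {bpt m}

/-- **One Lipschitz step.** Under A (with constant `C_A ≥ 0`), I and P: for integer marks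
`α, β, γ` and a site `k` with `R ≤ β − α + 1`, `R + 2 ≤ γ − β`, `2R + 1 ≤ k − γ`,
`|P[E(k+1)] − P[E(k)]| ≤ 3 C_A² / R²`. [folklore] -/
theorem abs_sub_succ_le {C_A : ℝ} (hC : 0 ≤ C_A)
    (hA : ∀ (k : ℤ) (R : ℕ), 1 ≤ R → μ.real (liso k R) ≤ C_A / R ∧ μ.real (riso k R) ≤ C_A / R)
    (hI : ∀ (α β γ k : ℤ) (R : ℕ), 1 ≤ R → (R : ℤ) ≤ β - α + 1 → (R : ℤ) + 2 ≤ γ - β →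
      2 * (R : ℤ) + 1 ≤ k - γ → ∀ ω : BondConfig (Site 2), ω ⊆ (zdGraph 2).edgeSet →
      ω ∈ symmDiff (firstHit halfPlane (rowIcc α β) γ k)
        (firstHit halfPlane (rowIcc (α - 1) (β - 1)) (γ - 1) k) →
      ω ∈ liso k R ∩ (liso β R ∪ riso (α - 1) R ∪ riso (γ - 1) R))
    (hP : ∀ (k k' : ℤ) (R : ℕ), 2 * (R : ℤ) < k - k' →
      μ.real (liso k R ∩ liso k' R) ≤ μ.real (liso k R) * μ.real (liso k' R) ∧
      μ.real (liso k R ∩ riso k' R) ≤ μ.real (liso k R) * μ.real (riso k' R))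
    (α β γ k : ℤ) (R : ℕ) (hR : 1 ≤ R) (h₁ : (R : ℤ) ≤ β - α + 1) (h₂ : (R : ℤ) + 2 ≤ γ - β)
    (h₃ : 2 * (R : ℤ) + 1 ≤ k - γ) :
    |μ.real (firstHit halfPlane (rowIcc α β) γ (k + 1)) -
        μ.real (firstHit halfPlane (rowIcc α β) γ k)| ≤ 3 * C_A ^ 2 / (R : ℝ) ^ 2 := by
  -- Step 1: exact translation, `P[E(k+1)] = P[E'(k)]` with the marks moved one site to the left.
  have hshift : μ.real (firstHit halfPlane (rowIcc α β) γ (k + 1)) =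
      μ.real (firstHit halfPlane (rowIcc (α - 1) (β - 1)) (γ - 1) k) := by
    have h := measureReal_firstHit_shift (rowIcc (α - 1) (β - 1)) (k₀ := γ - 1) (k := k) (by omega)
    simpa only [image_shift_rowIcc, sub_add_cancel] using h
  -- Step 2: `|P E' − P E| ≤ P (E ∆ E')`.
  have hsd : |μ.real (firstHit halfPlane (rowIcc (α - 1) (β - 1)) (γ - 1) k) -
      μ.real (firstHit halfPlane (rowIcc α β) γ k)| ≤
      μ.real (symmDiff (firstHit halfPlane (rowIcc α β) γ k)
        (firstHit halfPlane (rowIcc (α - 1) (β - 1)) (γ - 1) k)) := by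
    rw [abs_sub_comm]
    exact abs_measureReal_sub_le_measureReal_symmDiff
      (measurableSet_firstHit _ _ _ _).nullMeasurableSet
      (measurableSet_firstHit _ _ _ _).nullMeasurableSet
  -- Step 3: the four-case inclusion, almost surely (`P_{1/2}` lives on lattice configurations).
  have hincl : μ.real (symmDiff (firstHit halfPlane (rowIcc α β) γ k)
        (firstHit halfPlane (rowIcc (α - 1) (β - 1)) (γ - 1) k)) ≤
      μ.real (liso k R ∩ (liso β R ∪ riso (α - 1) R ∪ riso (γ - 1) R)) := by
    rw [measureReal_def, measureReal_def]
    refine ENNReal.toReal_mono (measure_ne_top _ _) (measure_mono_ae ?_)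
    filter_upwards [ae_subset_edgeSet (zdGraph 2) half] with ω hω hmem
    exact hI α β γ k R hR h₁ h₂ h₃ ω hω hmem
  -- Step 4: union bound.
  have hunion : μ.real (liso k R ∩ (liso β R ∪ riso (α - 1) R ∪ riso (γ - 1) R)) ≤
      μ.real (liso k R ∩ liso β R) + μ.real (liso k R ∩ riso (α - 1) R) +
        μ.real (liso k R ∩ riso (γ - 1) R) := by
    rw [Set.inter_union_distrib_left, Set.inter_union_distrib_left]
    exact (measureReal_union_le _ _).trans (add_le_add (measureReal_union_le _ _) le_rfl)
  -- Step 5: independence (P) and the point bound (A).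
  have hCR : 0 ≤ C_A / R := div_nonneg hC (Nat.cast_nonneg R)
  obtain ⟨hLk, -⟩ := hA k R hR
  obtain ⟨hLβ, -⟩ := hA β R hR
  obtain ⟨-, hRα⟩ := hA (α - 1) R hR
  obtain ⟨-, hRγ⟩ := hA (γ - 1) R hR
  have hb₁ : μ.real (liso k R ∩ liso β R) ≤ C_A / R * (C_A / R) :=
    (hP k β R (by omega)).1.trans (mul_le_mul hLk hLβ measureReal_nonneg hCR)
  have hb₂ : μ.real (liso k R ∩ riso (α - 1) R) ≤ C_A / R * (C_A / R) :=
    (hP k (α - 1) R (by omega)).2.trans (mul_le_mul hLk hRα measureReal_nonneg hCR)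
  have hb₃ : μ.real (liso k R ∩ riso (γ - 1) R) ≤ C_A / R * (C_A / R) :=
    (hP k (γ - 1) R (by omega)).2.trans (mul_le_mul hLk hRγ measureReal_nonneg hCR)
  have hring : 3 * C_A ^ 2 / (R : ℝ) ^ 2 = 3 * (C_A / R * (C_A / R)) := by ring
  rw [hshift, hring]
  linarith

/-- Telescoping of one-step bounds: if `|g (j+1) − g j| ≤ D` for all `j ≥ k` then
`|g (k+m) − g k| ≤ m D`. [folklore] -/
theorem abs_sub_le_mul_of_succ (g : ℤ → ℝ) {k : ℤ} {D : ℝ}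
    (h : ∀ j : ℤ, k ≤ j → |g (j + 1) - g j| ≤ D) : ∀ m : ℕ, |g (k + m) - g k| ≤ m * D := by
  intro m
  induction m with
  | zero => simp
  | succ m ih =>
    rw [show k + ((m + 1 : ℕ) : ℤ) = k + m + 1 by push_cast; ring]
    calc |g (k + m + 1) - g k| ≤ |g (k + m + 1) - g (k + m)| + |g (k + m) - g k| := abs_sub_le _ _ _
      _ ≤ D + m * D := add_le_add (h (k + m) (by omega)) ih
      _ = ((m + 1 : ℕ) : ℝ) * D := by push_cast; ring

/-- **STUB L, folded form.** From A, I, P: for `a < b < c < x₀ ≤ x₁` there is `C` with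
`|g n k' − g n k| ≤ C (k' − k)/n²` for all `n ≥ 1` and `⌊x₀ n⌋ ≤ k ≤ k' ≤ ⌊x₁ n⌋`, where
`g n k = P[firstHit halfPlane A_n ⌊cn⌋ k]`. [folklore] -/
theorem shiftLipschitz
    (hA : ∃ C : ℝ, ∀ (k : ℤ) (R : ℕ), 1 ≤ R → μ.real (liso k R) ≤ C / R ∧ μ.real (riso k R) ≤ C / R)
    (hI : ∀ (α β γ k : ℤ) (R : ℕ), 1 ≤ R → (R : ℤ) ≤ β - α + 1 → (R : ℤ) + 2 ≤ γ - β →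
      2 * (R : ℤ) + 1 ≤ k - γ → ∀ ω : BondConfig (Site 2), ω ⊆ (zdGraph 2).edgeSet →
      ω ∈ symmDiff (firstHit halfPlane (rowIcc α β) γ k)
        (firstHit halfPlane (rowIcc (α - 1) (β - 1)) (γ - 1) k) →
      ω ∈ liso k R ∩ (liso β R ∪ riso (α - 1) R ∪ riso (γ - 1) R))
    (hP : ∀ (k k' : ℤ) (R : ℕ), 2 * (R : ℤ) < k - k' →
      μ.real (liso k R ∩ liso k' R) ≤ μ.real (liso k R) * μ.real (liso k' R) ∧
      μ.real (liso k R ∩ riso k' R) ≤ μ.real (liso k R) * μ.real (riso k' R)) :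
    ∀ a b c x₀ x₁ : ℝ, a < b → b < c → c < x₀ → x₀ ≤ x₁ →
      ∃ C : ℝ, ∀ n : ℕ, 1 ≤ n → ∀ k k' : ℤ, ⌊x₀ * n⌋ ≤ k → k ≤ k' → k' ≤ ⌊x₁ * n⌋ →
        |μ.real (firstHit halfPlane (arcA a b n) ⌊c * n⌋ k') -
            μ.real (firstHit halfPlane (arcA a b n) ⌊c * n⌋ k)| ≤ C * (k' - k) / (n : ℝ) ^ 2 := by
  intro a b c x₀ _ hab hbc hcx _
  obtain ⟨C_A, hA⟩ := hA
  have hC : 0 ≤ C_A := by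
    have h := (hA 0 1 le_rfl).1
    rw [Nat.cast_one, div_one] at h
    exact measureReal_nonneg.trans h
  -- the scale `ε`: `4ε = min (b − a, c − b, x₀ − c)`
  set ε : ℝ := min (min (b - a) (c - b)) (x₀ - c) / 4 with hε_def
  have hmin : 0 < min (min (b - a) (c - b)) (x₀ - c) :=
    lt_min (lt_min (by linarith) (by linarith)) (by linarith)
  have hε : 0 < ε := div_pos hmin (by norm_num)
  have hεab : 4 * ε ≤ b - a := by
    have : min (min (b - a) (c - b)) (x₀ - c) ≤ b - a := (min_le_left _ _).trans (min_le_left _ _)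
    linarith
  have hεbc : 4 * ε ≤ c - b := by
    have : min (min (b - a) (c - b)) (x₀ - c) ≤ c - b := (min_le_left _ _).trans (min_le_right _ _)
    linarith
  have hεcx : 4 * ε ≤ x₀ - c := by
    have : min (min (b - a) (c - b)) (x₀ - c) ≤ x₀ - c := min_le_right _ _
    linarith
  -- threshold `n₀`: for `n ≥ n₀`, `ε n ≥ 2`
  obtain ⟨n₀, hn₀⟩ := exists_nat_ge (2 / ε)
  have hK₀ : 0 ≤ 12 * C_A ^ 2 / ε ^ 2 := by positivity
  refine ⟨12 * C_A ^ 2 / ε ^ 2 + (n₀ : ℝ) ^ 2, fun n hn k k' hk hkk' _ ↦ ?_⟩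
  have hn' : (0 : ℝ) < n := Nat.cast_pos.2 hn
  obtain ⟨m, rfl⟩ : ∃ m : ℕ, k' = k + m := ⟨(k' - k).toNat, by omega⟩
  rcases lt_or_ge n n₀ with hlt | hge
  · -- small `n`: the crude bound `|g n k' − g n k| ≤ 1`
    rcases Nat.eq_zero_or_pos m with rfl | hm
    · simp
    have hu₁ : μ.real (firstHit halfPlane (arcA a b n) ⌊c * n⌋ (k + m)) ≤ 1 := measureReal_le_one
    have hu₂ : μ.real (firstHit halfPlane (arcA a b n) ⌊c * n⌋ k) ≤ 1 := measureReal_le_one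
    have hl₁ : 0 ≤ μ.real (firstHit halfPlane (arcA a b n) ⌊c * n⌋ (k + m)) := measureReal_nonneg
    have hl₂ : 0 ≤ μ.real (firstHit halfPlane (arcA a b n) ⌊c * n⌋ k) := measureReal_nonneg
    have h1 : |μ.real (firstHit halfPlane (arcA a b n) ⌊c * n⌋ (k + m)) -
        μ.real (firstHit halfPlane (arcA a b n) ⌊c * n⌋ k)| ≤ 1 := by
      rw [abs_sub_le_iff]; constructor <;> linarith
    refine h1.trans ?_
    rw [le_div_iff₀ (by positivity), one_mul]
    have hm1 : (1 : ℝ) ≤ m := by exact_mod_cast hm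
    have hnn₀ : (n : ℝ) ^ 2 ≤ (n₀ : ℝ) ^ 2 := by
      have : (n : ℝ) ≤ n₀ := by exact_mod_cast hlt.le
      exact pow_le_pow_left₀ hn'.le this 2
    calc (n : ℝ) ^ 2 ≤ (n₀ : ℝ) ^ 2 := hnn₀
      _ ≤ 12 * C_A ^ 2 / ε ^ 2 + (n₀ : ℝ) ^ 2 := le_add_of_nonneg_left hK₀
      _ ≤ (12 * C_A ^ 2 / ε ^ 2 + (n₀ : ℝ) ^ 2) * (m : ℝ) :=
        le_mul_of_one_le_right (by positivity) hm1
      _ = _ := by push_cast; ring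
  · -- large `n`: `ε n ≥ 2`, radius `R = ⌊ε n⌋₊ ≥ 1`
    have hεn : 2 ≤ ε * n := by
      have h1 : (n₀ : ℝ) ≤ n := by exact_mod_cast hge
      have h2 := (div_le_iff₀ hε).1 (hn₀.trans h1)
      linarith
    set R : ℕ := ⌊ε * n⌋₊ with hR_def
    have hRle : (R : ℝ) ≤ ε * n := Nat.floor_le (by positivity)
    have hRlt : ε * n < R + 1 := Nat.lt_floor_add_one _
    have hR1 : 1 ≤ R := by
      rw [hR_def, Nat.one_le_floor_iff]
      linarith
    have hR1' : (1 : ℝ) ≤ R := by exact_mod_cast hR1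
    -- the integer marks
    have hαle : (⌊a * n⌋ : ℝ) ≤ a * n := Int.floor_le _
    have hβlt : b * n < ⌊b * n⌋ + 1 := Int.lt_floor_add_one _
    have hβle : (⌊b * n⌋ : ℝ) ≤ b * n := Int.floor_le _
    have hγlt : c * n < ⌊c * n⌋ + 1 := Int.lt_floor_add_one _
    have hγle : (⌊c * n⌋ : ℝ) ≤ c * n := Int.floor_le _
    have hxlt : x₀ * n < ⌊x₀ * n⌋ + 1 := Int.lt_floor_add_one _
    have hab' : 4 * ε * n ≤ (b - a) * n := mul_le_mul_of_nonneg_right hεab hn'.le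
    have hbc' : 4 * ε * n ≤ (c - b) * n := mul_le_mul_of_nonneg_right hεbc hn'.le
    have hcx' : 4 * ε * n ≤ (x₀ - c) * n := mul_le_mul_of_nonneg_right hεcx hn'.le
    have h₁ : (R : ℤ) ≤ ⌊b * n⌋ - ⌊a * n⌋ + 1 := by
      have h : (R : ℝ) < ⌊b * n⌋ - ⌊a * n⌋ + 1 := by linarith
      have h' : (R : ℤ) < ⌊b * n⌋ - ⌊a * n⌋ + 1 := by exact_mod_cast h
      omega
    have h₂ : (R : ℤ) + 2 ≤ ⌊c * n⌋ - ⌊b * n⌋ := by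
      have h : (R : ℝ) + 2 < ⌊c * n⌋ - ⌊b * n⌋ := by linarith
      have h' : (R : ℤ) + 2 < ⌊c * n⌋ - ⌊b * n⌋ := by exact_mod_cast h
      omega
    have h₃ : ∀ j : ℤ, k ≤ j → 2 * (R : ℤ) + 1 ≤ j - ⌊c * n⌋ := by
      intro j hj
      have h : 2 * (R : ℝ) + 1 < ⌊x₀ * n⌋ - ⌊c * n⌋ := by linarith
      have h' : 2 * (R : ℤ) + 1 < ⌊x₀ * n⌋ - ⌊c * n⌋ := by exact_mod_cast h
      omega
    -- one-step bounds for all sites `j ≥ k` (note `arcA a b n = rowIcc ⌊an⌋ ⌊bn⌋` definitionally)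
    have hstep : ∀ j : ℤ, k ≤ j →
        |μ.real (firstHit halfPlane (arcA a b n) ⌊c * n⌋ (j + 1)) -
          μ.real (firstHit halfPlane (arcA a b n) ⌊c * n⌋ j)| ≤ 3 * C_A ^ 2 / (R : ℝ) ^ 2 :=
      fun j hj ↦ abs_sub_succ_le hC hA hI hP ⌊a * n⌋ ⌊b * n⌋ ⌊c * n⌋ j R hR1 h₁ h₂ (h₃ j hj)
    -- telescoping
    have htel := abs_sub_le_mul_of_succ
      (fun j ↦ μ.real (firstHit halfPlane (arcA a b n) ⌊c * n⌋ j)) hstep m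
    -- `3 C_A² / R² ≤ C / n²`
    have hεne : ε ≠ 0 := hε.ne'
    have hD : 3 * C_A ^ 2 / (R : ℝ) ^ 2 ≤ (12 * C_A ^ 2 / ε ^ 2 + (n₀ : ℝ) ^ 2) / (n : ℝ) ^ 2 := by
      have hR2 : ε * n ≤ 2 * R := by linarith
      have hRpos : (0 : ℝ) < R := by linarith
      rw [div_le_div_iff₀ (by positivity) (by positivity)]
      have h4 : (ε * n) ^ 2 ≤ (2 * R) ^ 2 := pow_le_pow_left₀ (by positivity) hR2 2
      calc 3 * C_A ^ 2 * (n : ℝ) ^ 2 = 3 * C_A ^ 2 / ε ^ 2 * (ε * n) ^ 2 := by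
            field_simp
        _ ≤ 3 * C_A ^ 2 / ε ^ 2 * (2 * R) ^ 2 := mul_le_mul_of_nonneg_left h4 (by positivity)
        _ = 12 * C_A ^ 2 / ε ^ 2 * (R : ℝ) ^ 2 := by ring
        _ ≤ (12 * C_A ^ 2 / ε ^ 2 + (n₀ : ℝ) ^ 2) * (R : ℝ) ^ 2 :=
          mul_le_mul_of_nonneg_right (le_add_of_nonneg_right (by positivity)) (by positivity)
    calc _ ≤ (m : ℝ) * (3 * C_A ^ 2 / (R : ℝ) ^ 2) := htel
      _ ≤ (m : ℝ) * ((12 * C_A ^ 2 / ε ^ 2 + (n₀ : ℝ) ^ 2) / (n : ℝ) ^ 2) :=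
        mul_le_mul_of_nonneg_left hD (Nat.cast_nonneg m)
      _ = _ := by push_cast; ring

end Shift

/-- STUB L (assembly of A, I, P with exact translation `measureReal_firstHit_shift`: the lattice mark
density is Lipschitz at scale `n⁻²` on compact windows of `(c,∞)`; stated as an implication from the
three statements A, I, P, copied verbatim). [folklore] -/
theorem stub_shiftLipschitz_of :
    (∃ C : ℝ, ∀ (k : ℤ) (R : ℕ), 1 ≤ R →
      μ.real (openCrossing {v : Site 2 | 0 ≤ v 1 ∧ v 1 ≤ (R : ℤ) ∧ k - R ≤ v 0 ∧ v 0 ≤ k + R} {bpt k}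
      {v : Site 2 | v 0 = k - R ∨ v 0 = k + R ∨ v 1 = (R : ℤ)} \
      openCrossing {v : Site 2 | 0 ≤ v 1 ∧ v 1 ≤ (R : ℤ) ∧ k - R ≤ v 0 ∧ v 0 ≤ k + R}
      (rowIcc (k - R) (k - 1)) {bpt k}) ≤ C / R ∧
      μ.real (openCrossing {v : Site 2 | 0 ≤ v 1 ∧ v 1 ≤ (R : ℤ) ∧ k - R ≤ v 0 ∧ v 0 ≤ k + R} {bpt k}
      {v : Site 2 | v 0 = k - R ∨ v 0 = k + R ∨ v 1 = (R : ℤ)} \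
      openCrossing {v : Site 2 | 0 ≤ v 1 ∧ v 1 ≤ (R : ℤ) ∧ k - R ≤ v 0 ∧ v 0 ≤ k + R}
      (rowIcc (k + 1) (k + R)) {bpt k}) ≤ C / R) →
    (∀ (α β γ k : ℤ) (R : ℕ), 1 ≤ R → (R : ℤ) ≤ β - α + 1 → (R : ℤ) + 2 ≤ γ - β →
      2 * (R : ℤ) + 1 ≤ k - γ → ∀ ω : BondConfig (Site 2), ω ⊆ (zdGraph 2).edgeSet →
      ω ∈ symmDiff (firstHit halfPlane (rowIcc α β) γ k)
      (firstHit halfPlane (rowIcc (α - 1) (β - 1)) (γ - 1) k) →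
      ω ∈ (openCrossing {v : Site 2 | 0 ≤ v 1 ∧ v 1 ≤ (R : ℤ) ∧ k - R ≤ v 0 ∧ v 0 ≤ k + R} {bpt k}
      {v : Site 2 | v 0 = k - R ∨ v 0 = k + R ∨ v 1 = (R : ℤ)} \
      openCrossing {v : Site 2 | 0 ≤ v 1 ∧ v 1 ≤ (R : ℤ) ∧ k - R ≤ v 0 ∧ v 0 ≤ k + R}
      (rowIcc (k - R) (k - 1)) {bpt k}) ∩
      ((openCrossing {v : Site 2 | 0 ≤ v 1 ∧ v 1 ≤ (R : ℤ) ∧ β - R ≤ v 0 ∧ v 0 ≤ β + R} {bpt β}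
      {v : Site 2 | v 0 = β - R ∨ v 0 = β + R ∨ v 1 = (R : ℤ)} \
      openCrossing {v : Site 2 | 0 ≤ v 1 ∧ v 1 ≤ (R : ℤ) ∧ β - R ≤ v 0 ∧ v 0 ≤ β + R}
      (rowIcc (β - R) (β - 1)) {bpt β}) ∪
      (openCrossing {v : Site 2 | 0 ≤ v 1 ∧ v 1 ≤ (R : ℤ) ∧ (α - 1) - R ≤ v 0 ∧ v 0 ≤ (α - 1) + R}
      {bpt (α - 1)} {v : Site 2 | v 0 = (α - 1) - R ∨ v 0 = (α - 1) + R ∨ v 1 = (R : ℤ)} \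
      openCrossing {v : Site 2 | 0 ≤ v 1 ∧ v 1 ≤ (R : ℤ) ∧ (α - 1) - R ≤ v 0 ∧ v 0 ≤ (α - 1) + R}
      (rowIcc ((α - 1) + 1) ((α - 1) + R)) {bpt (α - 1)}) ∪
      (openCrossing {v : Site 2 | 0 ≤ v 1 ∧ v 1 ≤ (R : ℤ) ∧ (γ - 1) - R ≤ v 0 ∧ v 0 ≤ (γ - 1) + R}
      {bpt (γ - 1)} {v : Site 2 | v 0 = (γ - 1) - R ∨ v 0 = (γ - 1) + R ∨ v 1 = (R : ℤ)} \
      openCrossing {v : Site 2 | 0 ≤ v 1 ∧ v 1 ≤ (R : ℤ) ∧ (γ - 1) - R ≤ v 0 ∧ v 0 ≤ (γ - 1) + R}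
      (rowIcc ((γ - 1) + 1) ((γ - 1) + R)) {bpt (γ - 1)}))) →
    (∀ (k k' : ℤ) (R : ℕ), 2 * (R : ℤ) < k - k' →
      μ.real ((openCrossing {v : Site 2 | 0 ≤ v 1 ∧ v 1 ≤ (R : ℤ) ∧ k - R ≤ v 0 ∧ v 0 ≤ k + R} {bpt k}
      {v : Site 2 | v 0 = k - R ∨ v 0 = k + R ∨ v 1 = (R : ℤ)} \
      openCrossing {v : Site 2 | 0 ≤ v 1 ∧ v 1 ≤ (R : ℤ) ∧ k - R ≤ v 0 ∧ v 0 ≤ k + R}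
      (rowIcc (k - R) (k - 1)) {bpt k}) ∩
      (openCrossing {v : Site 2 | 0 ≤ v 1 ∧ v 1 ≤ (R : ℤ) ∧ k' - R ≤ v 0 ∧ v 0 ≤ k' + R} {bpt k'}
      {v : Site 2 | v 0 = k' - R ∨ v 0 = k' + R ∨ v 1 = (R : ℤ)} \
      openCrossing {v : Site 2 | 0 ≤ v 1 ∧ v 1 ≤ (R : ℤ) ∧ k' - R ≤ v 0 ∧ v 0 ≤ k' + R}
      (rowIcc (k' - R) (k' - 1)) {bpt k'})) ≤
      μ.real (openCrossing {v : Site 2 | 0 ≤ v 1 ∧ v 1 ≤ (R : ℤ) ∧ k - R ≤ v 0 ∧ v 0 ≤ k + R} {bpt k}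
      {v : Site 2 | v 0 = k - R ∨ v 0 = k + R ∨ v 1 = (R : ℤ)} \
      openCrossing {v : Site 2 | 0 ≤ v 1 ∧ v 1 ≤ (R : ℤ) ∧ k - R ≤ v 0 ∧ v 0 ≤ k + R}
      (rowIcc (k - R) (k - 1)) {bpt k}) *
      μ.real (openCrossing {v : Site 2 | 0 ≤ v 1 ∧ v 1 ≤ (R : ℤ) ∧ k' - R ≤ v 0 ∧ v 0 ≤ k' + R} {bpt k'}
      {v : Site 2 | v 0 = k' - R ∨ v 0 = k' + R ∨ v 1 = (R : ℤ)} \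
      openCrossing {v : Site 2 | 0 ≤ v 1 ∧ v 1 ≤ (R : ℤ) ∧ k' - R ≤ v 0 ∧ v 0 ≤ k' + R}
      (rowIcc (k' - R) (k' - 1)) {bpt k'}) ∧
      μ.real ((openCrossing {v : Site 2 | 0 ≤ v 1 ∧ v 1 ≤ (R : ℤ) ∧ k - R ≤ v 0 ∧ v 0 ≤ k + R} {bpt k}
      {v : Site 2 | v 0 = k - R ∨ v 0 = k + R ∨ v 1 = (R : ℤ)} \
      openCrossing {v : Site 2 | 0 ≤ v 1 ∧ v 1 ≤ (R : ℤ) ∧ k - R ≤ v 0 ∧ v 0 ≤ k + R}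
      (rowIcc (k - R) (k - 1)) {bpt k}) ∩
      (openCrossing {v : Site 2 | 0 ≤ v 1 ∧ v 1 ≤ (R : ℤ) ∧ k' - R ≤ v 0 ∧ v 0 ≤ k' + R} {bpt k'}
      {v : Site 2 | v 0 = k' - R ∨ v 0 = k' + R ∨ v 1 = (R : ℤ)} \
      openCrossing {v : Site 2 | 0 ≤ v 1 ∧ v 1 ≤ (R : ℤ) ∧ k' - R ≤ v 0 ∧ v 0 ≤ k' + R}
      (rowIcc (k' + 1) (k' + R)) {bpt k'})) ≤
      μ.real (openCrossing {v : Site 2 | 0 ≤ v 1 ∧ v 1 ≤ (R : ℤ) ∧ k - R ≤ v 0 ∧ v 0 ≤ k + R} {bpt k}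
      {v : Site 2 | v 0 = k - R ∨ v 0 = k + R ∨ v 1 = (R : ℤ)} \
      openCrossing {v : Site 2 | 0 ≤ v 1 ∧ v 1 ≤ (R : ℤ) ∧ k - R ≤ v 0 ∧ v 0 ≤ k + R}
      (rowIcc (k - R) (k - 1)) {bpt k}) *
      μ.real (openCrossing {v : Site 2 | 0 ≤ v 1 ∧ v 1 ≤ (R : ℤ) ∧ k' - R ≤ v 0 ∧ v 0 ≤ k' + R} {bpt k'}
      {v : Site 2 | v 0 = k' - R ∨ v 0 = k' + R ∨ v 1 = (R : ℤ)} \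
      openCrossing {v : Site 2 | 0 ≤ v 1 ∧ v 1 ≤ (R : ℤ) ∧ k' - R ≤ v 0 ∧ v 0 ≤ k' + R}
      (rowIcc (k' + 1) (k' + R)) {bpt k'})) →
    ∀ a b c x₀ x₁ : ℝ, a < b → b < c → c < x₀ → x₀ ≤ x₁ →
      ∃ C : ℝ, ∀ n : ℕ, 1 ≤ n → ∀ k k' : ℤ, ⌊x₀ * n⌋ ≤ k → k ≤ k' → k' ≤ ⌊x₁ * n⌋ →
        |μ.real (firstHit halfPlane (arcA a b n) ⌊c * n⌋ k') -
            μ.real (firstHit halfPlane (arcA a b n) ⌊c * n⌋ k)| ≤ C * (k' - k) / (n : ℝ) ^ 2 := by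
  intro hA hI hP
  exact Shift.shiftLipschitz hA hI hP

/-- **STUB L of line `Sketch` (registered signature, unconditional form): the lattice mark density is
Lipschitz at scale `n⁻²` on compact windows of `(c,∞)`** — `stub_shiftLipschitz_of` applied to the
landed stubs A (`stub_twoArmPoint`), I (`stub_symmDiffInclusion`), P (`stub_isolationIndep`). [folklore] -/
theorem stub_shiftLipschitz :
    ∀ a b c x₀ x₁ : ℝ, a < b → b < c → c < x₀ → x₀ ≤ x₁ →
      ∃ C : ℝ, ∀ n : ℕ, 1 ≤ n → ∀ k k' : ℤ, ⌊x₀ * n⌋ ≤ k → k ≤ k' → k' ≤ ⌊x₁ * n⌋ →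
        |μ.real (firstHit halfPlane (arcA a b n) ⌊c * n⌋ k') -
            μ.real (firstHit halfPlane (arcA a b n) ⌊c * n⌋ k)| ≤ C * (k' - k) / (n : ℝ) ^ 2 :=
  stub_shiftLipschitz_of stub_twoArmPoint stub_symmDiffInclusion stub_isolationIndep

end Summit.CriticalPhenomena.CardyFormulaZ2.Cruxes.HalfPlaneMarkDensityLaw.SketchLine
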